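import Literature.NumberTheory.EllipticCurves.CMTorsionGaloisImageProofs
import Literature.NumberTheory.EllipticCurves.HeegnerPointsKolyvaginPairing
import Literature.NumberTheory.EllipticCurves.GaloisActionProofs
import Literature.NumberTheory.EllipticCurves.KummerMap
import HarnessLib

/-!
# Route `CMKolyvaginAtInertTwo`, crux `CMKolyvaginExactAtInertTwo` (stmt-BirchSwinnertonDyer-24277):
# the binder `hcomm` — Galois elements commuting with a CM generator INERT at `2` (part 1/3:
# `E[2]` as a line over `𝔽₄ = ℤ[η]/2`, the Galois dichotomy, who commutes with `η`)

Cell `bsd-print-cf2`, seat ty2 (the DISCHARGE INTERFACE: habitat predicate ⟹ the hypotheses the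
line's theorems consume, sorry-free). HONEST FRAMING: THEOREMS ONLY — no definition, no named fact,
no route file imported, nothing about BSD asserted; no item is closed by this file.

WHAT IS DISCHARGED (by the three files `CMKolyvaginCartanCommuteAtTwo{,Level,Classes}`). The
level-`2^M` files of seat `bsd-line-cmk2-p1` (Gross Prop. 9.1 / McCallum (2) at `p = 2`:
`KolyvaginImageTwo.h1_restriction_injective_two_pow`, `exists_h1Eval_eq_two_pow`; the Čebotarev leaf
and the `(−ε)`/`τ`-part descents at level `2^M`) carry the hypothesis

  `hcomm : ∀ π ∈ torsionFixing V 2, ∀ P : geomTorsion V (2^M), π • z • P = z • π • P`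

for an element `z ∈ Γ` without non-zero fixed point on `E[2]` ("that CM input is NOT in the tree at
`2`-power level", KERNEL-STATUS-p2-port.md, "THE ONE NEW HYPOTHESIS"). These files prove it from an
endomorphism `η ∈ End_{k̄}(E)` with

  `η ∘ η + m·η = c`, `m` and `c` ODD                                                    (★)

— i.e. `ℤ[η] ≅ ℤ[x]/(x² + mx − c)` with `x² + mx − c ≡ x² + x + 1 (mod 2)` irreducible: **`2` is INERT
in the order `ℤ[η]`** (for the maximal orders `ℤ[ω_d]`, `d ≡ 5 (mod 8)`: `η = ω_d`, `m = −d`,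
`c = −d(d−1)/4`; the file `…Classes` supplies `η` on the habitat from
`Cox2013_exists_ringEquiv_cmRing_geomEndRing_holds`, transports the conclusion along the kernel-`x`
`3`-isogeny for `j = −12288000`, and along base change `ℚ̄ → K̄`).

THE ARGUMENT (Lang, *Elliptic Functions*, Ch. 10 §4, Remark — endomorphisms are defined over the CM
field `F` and `Γ_F` acts `End`-linearly; here at `2`-power level, elementary). This file:
* §1 on `E[2]`: `η` acts without non-zero fixed point, `η(ηQ) = Q + ηQ`, and
  `E[2] = {0, Q, ηQ, Q + ηQ}` for any `Q ≠ 0` (`#E[2] = 4`) — `E[2]` is a line over `𝔽₄ = ℤ[η]/2`;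
* §2 GALOIS DICHOTOMY (`dichotomy`): for `σ ∈ Γ_k` the conjugate `σησ⁻¹ ∈ End_{k̄}(E)` (tree
  `conj_mem_geomEndRing`) satisfies (★) too, so `(σησ⁻¹ − η)(σησ⁻¹ + η + m) = 0` in the commutative
  domain `End_{k̄}(E)` (`geomEndRing_comm_holds`, `isDomain_geomEndRing`): **`σ` commutes with `η`,
  or `σησ⁻¹ = −η − m`** (the cases `σ ∈ Γ_F` / `σ ∉ Γ_F` of Lang's Remark);
* §3 in the second case `σ` acts on `E[2]` `𝔽₄`-semilinearly, i.e. as a TRANSPOSITION of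
  `{Q, ηQ, Q + ηQ}`: so an element without non-zero fixed point on `E[2]`
  (`commute_of_fixedPointFree`) and an element acting trivially on `E[2]` (`commute_of_trivial`)
  both COMMUTE with `η`.
Part 2 (`…Level`): `E[2^M] = ℤP₁ + ℤηP₁`, the engine, transport lemmas. Part 3 (`…Classes`): the
habitat `H₂` over `ℚ` and over number fields `K` — the consumers' binder verbatim.

For a non-CM curve with large `2`-adic image `hcomm` can fail; (★) is exactly what rules this out.
beyond-print theorem: NO (Lang Ch. 10 §4 Remark read on `2`-power torsion; elementary algebra).
BSD is not proved by any of this; no summit statement is proved by this seat.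

References: S. Lang, *Elliptic Functions*, GTM 112 (1987), Ch. 10 §4 Remark [Lang1987];
B. Gross, in *L-functions and Arithmetic*, LMS LN 153 (1991), §9 Prop. 9.1 [GrossLMS1991];
W. McCallum, ibid., §3 (2) [McCallumLMS1991]; J. H. Silverman, *AEC* 2nd ed., III.§4, Cor. III.6.4(b)
[SilvermanAEC2009].
-/

set_option autoImplicit false

noncomputable section

open scoped Classical

namespace Summit.BirchSwinnertonDyer.Rank1Residual.P2.CartanAtTwo

open WeierstrassCurve Field
open Literature.NumberTheory.EllipticCurves

universe u

/-! ## §1 The `2`-torsion as a line over `ℤ[η]/2 = 𝔽₄` -/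

section TwoTorsion

variable {k : Type u} [Field k] {V : WeierstrassCurve k}

/-- An odd multiple of a `2`-torsion point is the point. [folklore] -/
theorem zsmul_eq_self_of_odd {P : geomPoints V} (h2 : (2 : ℤ) • P = 0) {m : ℤ} (hm : Odd m) :
    m • P = P := by
  obtain ⟨r, rfl⟩ := hm
  rw [add_zsmul, one_zsmul, mul_comm, mul_zsmul, h2, zsmul_zero, zero_add]

/-- A `2`-torsion point is its own negative. [folklore] -/
theorem neg_eq_self_of_two_zsmul {P : geomPoints V} (h2 : (2 : ℤ) • P = 0) : -P = P := by
  rw [two_zsmul] at h2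
  exact (eq_neg_of_add_eq_zero_left h2).symm

variable {η : AddMonoid.End (geomPoints V)} {m c : ℤ}

/-- An additive endomorphism preserves the `2`-torsion. [folklore] -/
theorem two_zsmul_map_eq_zero (η : AddMonoid.End (geomPoints V)) {P : geomPoints V}
    (h2 : (2 : ℤ) • P = 0) : (2 : ℤ) • η P = 0 := by
  rw [← map_zsmul, h2, map_zero]

/-- **`η² = η + 1` on `E[2]`**: for `η` with `η(ηP) + m·ηP = c·P` (`m`, `c` odd) and `2Q = 0`,
`η(ηQ) = Q + ηQ`. [folklore] -/
theorem eta_eta_of_two_zsmul (hrel : ∀ P : geomPoints V, η (η P) + m • η P = c • P)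
    (hm : Odd m) (hc : Odd c) {Q : geomPoints V} (h2 : (2 : ℤ) • Q = 0) :
    η (η Q) = Q + η Q := by
  have h := hrel Q
  rw [zsmul_eq_self_of_odd (two_zsmul_map_eq_zero η h2) hm, zsmul_eq_self_of_odd h2 hc,
    ← eq_sub_iff_add_eq] at h
  rw [h, sub_eq_add_neg, neg_eq_self_of_two_zsmul (two_zsmul_map_eq_zero η h2)]

/-- `η` kills no non-zero `2`-torsion point. [folklore] -/
theorem eta_ne_zero (hrel : ∀ P : geomPoints V, η (η P) + m • η P = c • P)
    (hm : Odd m) (hc : Odd c) {Q : geomPoints V} (hQ : Q ≠ 0) (h2 : (2 : ℤ) • Q = 0) :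
    η Q ≠ 0 := by
  intro h0
  have h : Q = 0 := by simpa [h0] using (eta_eta_of_two_zsmul hrel hm hc h2).symm
  exact hQ h

/-- `η` fixes no non-zero `2`-torsion point (it acts on `E[2] ∖ 0` as a `3`-cycle). [folklore] -/
theorem eta_ne_self (hrel : ∀ P : geomPoints V, η (η P) + m • η P = c • P)
    (hm : Odd m) (hc : Odd c) {Q : geomPoints V} (hQ : Q ≠ 0) (h2 : (2 : ℤ) • Q = 0) :
    η Q ≠ Q := by
  intro h1
  have h := eta_eta_of_two_zsmul hrel hm hc h2
  rw [h1, h1, ← two_zsmul, h2] at h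
  exact hQ h

/-- `Q + ηQ ≠ 0` for a non-zero `2`-torsion point `Q`. [folklore] -/
theorem add_eta_ne_zero (hrel : ∀ P : geomPoints V, η (η P) + m • η P = c • P)
    (hm : Odd m) (hc : Odd c) {Q : geomPoints V} (hQ : Q ≠ 0) (h2 : (2 : ℤ) • Q = 0) :
    Q + η Q ≠ 0 := by
  intro h0
  have h : η Q = Q := by
    rw [add_comm] at h0
    rw [eq_neg_of_add_eq_zero_left h0, neg_eq_self_of_two_zsmul h2]
  exact eta_ne_self hrel hm hc hQ h2 h

/-- A type with four elements has a non-zero `2`-torsion point: `∃ Q ∈ E[2]`, `Q ≠ 0`. [folklore] -/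
theorem exists_two_torsion_ne_zero (hcard : Nat.card (geomTorsion V ((2 : ℕ) : ℤ)) = 4) :
    ∃ Q : geomPoints V, Q ≠ 0 ∧ (2 : ℤ) • Q = 0 := by
  haveI : Finite (geomTorsion V ((2 : ℕ) : ℤ)) := Nat.finite_of_card_ne_zero (by rw [hcard]; norm_num)
  haveI : Nontrivial (geomTorsion V ((2 : ℕ) : ℤ)) :=
    Finite.one_lt_card_iff_nontrivial.mp (by rw [hcard]; norm_num)
  obtain ⟨Q, hQ⟩ := exists_ne (0 : geomTorsion V ((2 : ℕ) : ℤ))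
  refine ⟨Q, fun h ↦ hQ (Subtype.ext h), ?_⟩
  have h := (mem_geomTorsion_iff V _ (Q : geomPoints V)).mp Q.2
  exact_mod_cast h

/-- **`E[2] = {0, Q, ηQ, Q + ηQ}`** for any non-zero `Q ∈ E[2]`, when `#E[2] = 4`: the four points are
distinct `2`-torsion points. (`E[2]` is free of rank one over `ℤ[η]/2 = 𝔽₄`.) [folklore] -/
theorem two_torsion_cases (hrel : ∀ P : geomPoints V, η (η P) + m • η P = c • P)
    (hm : Odd m) (hc : Odd c) (hcard : Nat.card (geomTorsion V ((2 : ℕ) : ℤ)) = 4)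
    {Q : geomPoints V} (hQ : Q ≠ 0) (h2Q : (2 : ℤ) • Q = 0)
    (P : geomPoints V) (h2P : (2 : ℤ) • P = 0) :
    P = 0 ∨ P = Q ∨ P = η Q ∨ P = Q + η Q := by
  haveI : Finite (geomTorsion V ((2 : ℕ) : ℤ)) := Nat.finite_of_card_ne_zero (by rw [hcard]; norm_num)
  letI : Fintype (geomTorsion V ((2 : ℕ) : ℤ)) := Fintype.ofFinite _
  have mem : ∀ {R : geomPoints V}, (2 : ℤ) • R = 0 → R ∈ geomTorsion V ((2 : ℕ) : ℤ) := fun h ↦ by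
    rw [mem_geomTorsion_iff]; exact_mod_cast h
  have h2η : (2 : ℤ) • η Q = 0 := two_zsmul_map_eq_zero η h2Q
  have h2s : (2 : ℤ) • (Q + η Q) = 0 := by rw [zsmul_add, h2Q, h2η, add_zero]
  set q : geomTorsion V ((2 : ℕ) : ℤ) := ⟨Q, mem h2Q⟩ with hq
  set e : geomTorsion V ((2 : ℕ) : ℤ) := ⟨η Q, mem h2η⟩ with he
  set s : geomTorsion V ((2 : ℕ) : ℤ) := ⟨Q + η Q, mem h2s⟩ with hs
  have hηQ0 : η Q ≠ 0 := eta_ne_zero hrel hm hc hQ h2Q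
  have hηQQ : η Q ≠ Q := eta_ne_self hrel hm hc hQ h2Q
  have hs0 : Q + η Q ≠ 0 := add_eta_ne_zero hrel hm hc hQ h2Q
  have h0q : (0 : geomTorsion V ((2 : ℕ) : ℤ)) ≠ q := fun h ↦ hQ (congrArg Subtype.val h).symm
  have h0e : (0 : geomTorsion V ((2 : ℕ) : ℤ)) ≠ e := fun h ↦ hηQ0 (congrArg Subtype.val h).symm
  have h0s : (0 : geomTorsion V ((2 : ℕ) : ℤ)) ≠ s := fun h ↦ hs0 (congrArg Subtype.val h).symm
  have hqe : q ≠ e := fun h ↦ hηQQ (congrArg Subtype.val h).symm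
  have hqs : q ≠ s := fun h ↦ hηQ0 (by
    have h' : Q = Q + η Q := congrArg Subtype.val h
    exact (left_eq_add.mp h').symm ▸ rfl)
  have hes : e ≠ s := fun h ↦ hQ (by
    have h' : η Q = Q + η Q := congrArg Subtype.val h
    exact left_eq_add.mp (h'.trans (add_comm _ _)))
  have hA : (0 : geomTorsion V ((2 : ℕ) : ℤ)) ∉ ({q, e, s} : Finset _) := by
    simp only [Finset.mem_insert, Finset.mem_singleton, not_or]; exact ⟨h0q, h0e, h0s⟩
  have hB : q ∉ ({e, s} : Finset _) := by
    simp only [Finset.mem_insert, Finset.mem_singleton, not_or]; exact ⟨hqe, hqs⟩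
  have hS : ({0, q, e, s} : Finset (geomTorsion V ((2 : ℕ) : ℤ))) = Finset.univ := by
    apply Finset.eq_univ_of_card
    rw [← Nat.card_eq_fintype_card, hcard, Finset.card_insert_of_notMem hA,
      Finset.card_insert_of_notMem hB, Finset.card_pair hes]
  have hP : (⟨P, mem h2P⟩ : geomTorsion V ((2 : ℕ) : ℤ)) ∈
      ({0, q, e, s} : Finset (geomTorsion V ((2 : ℕ) : ℤ))) := by
    rw [hS]; exact Finset.mem_univ _
  simp only [Finset.mem_insert, Finset.mem_singleton] at hP
  rcases hP with h | h | h | h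
  · exact Or.inl (congrArg Subtype.val h)
  · exact Or.inr (Or.inl (congrArg Subtype.val h))
  · exact Or.inr (Or.inr (Or.inl (congrArg Subtype.val h)))
  · exact Or.inr (Or.inr (Or.inr (congrArg Subtype.val h)))

end TwoTorsion

/-! ## §2 The Galois dichotomy: `σησ⁻¹ ∈ {η, −η − m}` -/

section Dichotomy

variable {k : Type u} [Field k] (V : WeierstrassCurve k) [CharZero k] [V.IsElliptic]

/-- **GALOIS DICHOTOMY.** For `η ∈ End_{k̄}(E)` with `η² + mη = c` and `σ ∈ Γ_k`: either `σ` commutes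
with `η` on `E(k̄)`, or `σ ∘ η ∘ σ⁻¹ = −η − m`, i.e. `η(σP) = −σ(ηP) − m·σP`. The conjugate
`x = σησ⁻¹` lies in `End_{k̄}(E)` (`conj_mem_geomEndRing`) and satisfies `x² + mx = c`, so
`(x − η)(x + η + m) = 0` in the commutative domain `End_{k̄}(E)` (Silverman, *AEC*, III.4.2(c),
III.9.4; Lang, Ch. 10 §4 Remark: the two cases are `σ ∈ Γ_F`, `σ ∉ Γ_F`). [cite: Lang1987, Ch. 10 §4, Remark] -/
theorem dichotomy {η : AddMonoid.End (geomPoints V)} {m c : ℤ} (hη : η ∈ V.geomEndRing)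
    (hrel : η * η + (m : AddMonoid.End (geomPoints V)) * η = (c : AddMonoid.End (geomPoints V)))
    (σ : absoluteGaloisGroup k) :
    (∀ P : geomPoints V, σ • η P = η (σ • P)) ∨
      (∀ P : geomPoints V, η (σ • P) = -(σ • η P) - m • σ • P) := by
  haveI := isDomain_geomEndRing V
  set cσ : absoluteGaloisGroup k →* AddMonoid.End (geomPoints V) :=
    DistribMulAction.toAddMonoidEnd (absoluteGaloisGroup k) (geomPoints V) with hcσ
  have hconjP : ∀ P : geomPoints V, (cσ σ * η * cσ σ⁻¹) P = σ • η (σ⁻¹ • P) := fun P ↦ rfl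
  have e1 : cσ σ⁻¹ * cσ σ = 1 := by rw [← map_mul, inv_mul_cancel, map_one]
  have e2 : cσ σ * cσ σ⁻¹ = 1 := by rw [← map_mul, mul_inv_cancel, map_one]
  -- the conjugate satisfies the same relation
  have hmem : cσ σ * η * cσ σ⁻¹ ∈ V.geomEndRing := conj_mem_geomEndRing V hη σ
  have hrelx : (cσ σ * η * cσ σ⁻¹) * (cσ σ * η * cσ σ⁻¹) +
      (m : AddMonoid.End (geomPoints V)) * (cσ σ * η * cσ σ⁻¹) = (c : AddMonoid.End (geomPoints V)) := by
    calc (cσ σ * η * cσ σ⁻¹) * (cσ σ * η * cσ σ⁻¹) +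
          (m : AddMonoid.End (geomPoints V)) * (cσ σ * η * cσ σ⁻¹)
        = cσ σ * (η * η + (m : AddMonoid.End (geomPoints V)) * η) * cσ σ⁻¹ := by
          rw [mul_add, add_mul]
          congr 1
          · simp only [mul_assoc]
            rw [← mul_assoc (cσ σ⁻¹) (cσ σ), e1, one_mul]
          · rw [← mul_assoc, ← mul_assoc, (Int.cast_commute m (cσ σ)).eq]
            simp only [mul_assoc]
      _ = cσ σ * (c : AddMonoid.End (geomPoints V)) * cσ σ⁻¹ := by rw [hrel]
      _ = (c : AddMonoid.End (geomPoints V)) := by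
          rw [← (Int.cast_commute c (cσ σ)).eq, mul_assoc, e2, mul_one]
  -- in the commutative domain `End_{k̄}(E)`: `(x - y)(x + y + m) = 0`
  set x : V.geomEndRing := ⟨cσ σ * η * cσ σ⁻¹, hmem⟩ with hx
  set y : V.geomEndRing := ⟨η, hη⟩ with hy
  have hxx : x * x + (m : V.geomEndRing) * x = (c : V.geomEndRing) :=
    Subtype.ext (by push_cast; exact hrelx)
  have hyy : y * y + (m : V.geomEndRing) * y = (c : V.geomEndRing) :=
    Subtype.ext (by push_cast; exact hrel)
  have hxy : x * y = y * x := Subtype.ext (V.geomEndRing_comm_holds _ _ x.2 y.2)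
  have hmx : (m : V.geomEndRing) * x = x * m := (Int.cast_commute m x).eq
  have hmy : (m : V.geomEndRing) * y = y * m := (Int.cast_commute m y).eq
  have hprod : (x - y) * (x + y + (m : V.geomEndRing)) = 0 := by
    calc (x - y) * (x + y + (m : V.geomEndRing))
        = (x * x + (m : V.geomEndRing) * x) - (y * y + (m : V.geomEndRing) * y) + (x * y - y * x) := by
          rw [hmx, hmy]; noncomm_ring
      _ = 0 := by rw [hxx, hyy, hxy, sub_self, sub_self, add_zero]
  rcases mul_eq_zero.mp hprod with h0 | h0
  · -- `σησ⁻¹ = η`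
    left
    have hfun : cσ σ * η * cσ σ⁻¹ = η := congrArg Subtype.val (sub_eq_zero.mp h0)
    intro P
    have h := congrArg (fun f : AddMonoid.End (geomPoints V) ↦ f (σ • P)) hfun
    simp only [hconjP, inv_smul_smul] at h
    exact h
  · -- `σησ⁻¹ = -η - m`
    right
    have hx' : x = -y - (m : V.geomEndRing) := by
      calc x = (x + y + (m : V.geomEndRing)) - y - m := by abel
        _ = -y - m := by rw [h0]; abel
    have hfun : cσ σ * η * cσ σ⁻¹ = -η - (m : AddMonoid.End (geomPoints V)) := by
      have h := congrArg Subtype.val hx'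
      push_cast at h
      exact h
    have happ : ∀ Q : geomPoints V,
        (-η - (m : AddMonoid.End (geomPoints V))) Q = -(η Q) - m • Q := fun Q ↦ rfl
    intro P
    have h := congrArg (fun f : AddMonoid.End (geomPoints V) ↦ f (σ • P)) hfun
    simp only [hconjP, inv_smul_smul, happ] at h
    rw [h]; abel

end Dichotomy

/-! ## §3 Who commutes with `η`: fixed-point-free elements and elements trivial on `E[2]` -/

section Commute

variable {k : Type u} [Field k] {V : WeierstrassCurve k} {η : AddMonoid.End (geomPoints V)} {m c : ℤ}

/-- In the case `σησ⁻¹ = −η − m`, on `E[2]` one has `η(σR) = σ(ηR) + σR` (`𝔽₄`-semilinearity).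
[folklore] -/
theorem anti_of_two_zsmul (hm : Odd m) {σ : absoluteGaloisGroup k}
    (h : ∀ P : geomPoints V, η (σ • P) = -(σ • η P) - m • σ • P) {R : geomPoints V}
    (h2R : (2 : ℤ) • R = 0) : η (σ • R) = σ • η R + σ • R := by
  have h2σR : (2 : ℤ) • σ • R = 0 := by rw [← smul_zsmul_geomPoints V 2 σ R, h2R, smul_zero]
  have h2σηR : (2 : ℤ) • σ • η R = 0 := by
    rw [← smul_zsmul_geomPoints V 2 σ (η R), two_zsmul_map_eq_zero η h2R, smul_zero]
  rw [h R, zsmul_eq_self_of_odd h2σR hm, neg_eq_self_of_two_zsmul h2σηR, sub_eq_add_neg,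
    neg_eq_self_of_two_zsmul h2σR]

/-- **An element without non-zero fixed point on `E[2]` commutes with `η`.** In the other case of the
dichotomy `σ` would act on `E[2] ∖ 0 = {Q, ηQ, Q + ηQ}` as a transposition: `σQ = ηQ` forces
`σ(Q + ηQ) = Q + ηQ`, and `σQ = Q + ηQ` forces `σ(ηQ) = ηQ`. [cite: Lang1987, Ch. 10 §4, Remark] -/
theorem commute_of_fixedPointFree (hrel : ∀ P : geomPoints V, η (η P) + m • η P = c • P)
    (hm : Odd m) (hc : Odd c) (hcard : Nat.card (geomTorsion V ((2 : ℕ) : ℤ)) = 4)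
    {σ : absoluteGaloisGroup k}
    (hdich : (∀ P : geomPoints V, σ • η P = η (σ • P)) ∨
      (∀ P : geomPoints V, η (σ • P) = -(σ • η P) - m • σ • P))
    (hσ : ∀ P : geomPoints V, (2 : ℤ) • P = 0 → σ • P = P → P = 0) :
    ∀ P : geomPoints V, σ • η P = η (σ • P) := by
  rcases hdich with h | h
  · exact h
  exfalso
  obtain ⟨Q, hQ, h2Q⟩ := exists_two_torsion_ne_zero hcard
  have h2ηQ : (2 : ℤ) • η Q = 0 := two_zsmul_map_eq_zero η h2Q
  have h2s : (2 : ℤ) • (Q + η Q) = 0 := by rw [zsmul_add, h2Q, h2ηQ, add_zero]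
  have h2σQ : (2 : ℤ) • σ • Q = 0 := by rw [← smul_zsmul_geomPoints V 2 σ Q, h2Q, smul_zero]
  have hηη : η (η Q) = Q + η Q := eta_eta_of_two_zsmul hrel hm hc h2Q
  have anti := anti_of_two_zsmul hm h h2Q
  rcases two_torsion_cases hrel hm hc hcard hQ h2Q (σ • Q) h2σQ with h0 | h1 | h2 | h3
  · -- `σQ = 0`
    have h' := congrArg (σ⁻¹ • ·) h0
    simp only [inv_smul_smul, smul_zero] at h'
    exact hQ h'
  · -- `σQ = Q`
    exact hQ (hσ Q h2Q h1)
  · -- `σQ = ηQ`: then `σ(ηQ) = Q`, so `Q + ηQ` is fixed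
    rw [h2, hηη] at anti
    have hσηQ : σ • η Q = Q := (add_right_cancel anti).symm
    have hfix : σ • (Q + η Q) = Q + η Q := by rw [smul_add, h2, hσηQ, add_comm]
    exact add_eta_ne_zero hrel hm hc hQ h2Q (hσ _ h2s hfix)
  · -- `σQ = Q + ηQ`: then `ηQ` is fixed
    rw [h3, map_add, hηη, ← add_assoc, add_comm (η Q) Q] at anti
    have hσηQ : σ • η Q = η Q := by
      have h' : Q + η Q + η Q = Q + η Q + σ • η Q := by rw [anti, add_comm (σ • η Q)]
      exact (add_left_cancel h').symm
    exact eta_ne_zero hrel hm hc hQ h2Q (hσ _ h2ηQ hσηQ)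

/-- **An element acting trivially on `E[2]` commutes with `η`.** In the other case of the dichotomy
`ηQ = η(τQ) = τ(ηQ) + τQ = ηQ + Q` would force `Q = 0`. [cite: Lang1987, Ch. 10 §4, Remark] -/
theorem commute_of_trivial (hm : Odd m) (hcard : Nat.card (geomTorsion V ((2 : ℕ) : ℤ)) = 4)
    {τ : absoluteGaloisGroup k}
    (hdich : (∀ P : geomPoints V, τ • η P = η (τ • P)) ∨
      (∀ P : geomPoints V, η (τ • P) = -(τ • η P) - m • τ • P))
    (hτ : ∀ P : geomPoints V, (2 : ℤ) • P = 0 → τ • P = P) :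
    ∀ P : geomPoints V, τ • η P = η (τ • P) := by
  rcases hdich with h | h
  · exact h
  exfalso
  obtain ⟨Q, hQ, h2Q⟩ := exists_two_torsion_ne_zero hcard
  have anti := anti_of_two_zsmul hm h h2Q
  rw [hτ Q h2Q, hτ (η Q) (two_zsmul_map_eq_zero η h2Q)] at anti
  exact hQ (left_eq_add.mp anti)

end Commute

end Summit.BirchSwinnertonDyer.Rank1Residual.P2.CartanAtTwo

end
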